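import Mathlib
import Summits.CriticalPhenomena.PercolationContinuityZ3.Theorems.PercNearOneGluingNoHeavyLowerTailOrientedAntipodalHallTwoSidedCertificateCoInt

/-!
# CoI-Kleitman for 'opposite star + acyclic' type digraphs (any number of petals)

Helper file for crux `stmt-CriticalPhenomena-4575` (`NoHeavyLowerTail`, route `PercNearOneGluingNoHeavy`), hull-port seat
`prim-hp-7` (generation 54); `--supports stmt-CriticalPhenomena-4575`.  Everything here is PROVED.  Setting of
`…OrientedAntipodalHall` (prim-ineq-gen-1/3): `f : Finset α → Lab k` monotone, ground set `S`, antipodal bads `X ⊆ S` of type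
`(i X, j X)`, goods `U ⊆ S` (`f U = A`, `f (S \ U) = B`).

**Theorem (`exists_injective_good_above_of_coint_starAcyclic`).**  Fix a petal `v` and weights `σ : Fin k → ℕ`.  Let `D` be a
CO-INTERSECTING family of antipodal bads (`i X ≠ j X`, `X ∪ X' ≠ S`) such that every type `(i X, j X)` either touches `v` (in
either direction, both directions allowed — these are the opposite pairs) or goes up in `σ` (`σ (i X) < σ (j X)`).  Then the
bads of `D` have DISTINCT good representatives above them (IC/CoI-Kleitman for the class 'opposite star at `v` + acyclic
rest').  This one statement contains the acyclic theorem (prim-hp-7 g49 / prim-l12-p2 / prim-ineq-gen-3: no type touches an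
opposite), prim-ineq-gen-3's cyclic triangle `{v→b, b→c, c→v}` (the one type avoiding `v` is a single arc), the two-petal
co-intersecting theorem of prim-hp-7 g50 (`{v→b, b→v}`), and this generation's classes `T4`, `T4'`, `T5` on three petals and
`M1` on four petals (`…CoIntThreePetals`, `…TwoSidedCertificateCoIntInstances`).

**Proof** = one label-level certificate for the co-intersecting table theorem `exists_injective_good_above_of_twoSidedCertCoInt`
(file `…TwoSidedCertificateCoInt`): members PLAIN for the bads with tail `v`, COMPLEMENTED otherwise; pseudo-classes `Φ_s` for
all `s ≠ v` (no `Ψ`); ranks: a complemented `(p,q)` with `p, q ≠ v` gets `σ q` and so does `Φ_q`; the complemented `(p,v)` get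
`N`, the plain `(v,q)` get `N + 1`, where `N` exceeds every `σ`.  The label conditions reduce to the arithmetic of `σ`; the one
place where co-intersection is needed beyond injectivity is a complemented `(p,v)` preceding the plain `(v,p)` (equal label
pairs).  Machine check of the certificate conditions for ALL 17 510 type sets on `≤ 5` petals satisfying the hypothesis
(`prim-hp-7/code/gen54/lab54/starclass.py`): 0 failures.  (prim-hp-7 gen 54, 2026-08-22; memo
`prim-hp-7/FROM-prim-hp-7-g54-THREE-PETALS.md`.)
-/

namespace Summit.CriticalPhenomena.PercolationContinuityZ3.Theorems

namespace OrientedAntipodalHall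

open Finset AntipodalStrongHarris AntipodalStrongHarris.Lab
open scoped FinsetFamily

variable {α : Type*} [DecidableEq α] {k : ℕ}

/-- **CoI-Kleitman for the class 'opposite star at `v` + acyclic rest'.**  `f` monotone; `D` a co-intersecting family of
antipodal bads of `S` whose every type `(i X, j X)` has `i X = v`, or `j X = v`, or `σ (i X) < σ (j X)`.  Then there is an
injective `φ` on `D` with `X ⊆ φ X ⊆ S`, `f (φ X) = A`, `f (S \ φ X) = B`. [this work] -/
theorem exists_injective_good_above_of_coint_starAcyclic (S : Finset α) {f : Finset α → Lab k}
    (hf : ∀ ⦃X Y : Finset α⦄, X ⊆ Y → f X ≤ f Y) (D : Finset (Finset α)) (i j : Finset α → Fin k)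
    (hDS : ∀ X ∈ D, X ⊆ S) (hDi : ∀ X ∈ D, f X = petal (i X)) (hDj : ∀ X ∈ D, f (S \ X) = petal (j X))
    (hij : ∀ X ∈ D, i X ≠ j X) (v : Fin k) (σ : Fin k → ℕ)
    (hT : ∀ X ∈ D, i X = v ∨ j X = v ∨ σ (i X) < σ (j X))
    (hco : ∀ X ∈ D, ∀ X' ∈ D, X ∪ X' ≠ S) :
    ∃ φ : D → Finset α, Function.Injective φ ∧
      ∀ X : D, (X : Finset α) ⊆ φ X ∧ φ X ⊆ S ∧ f (φ X) = top ∧ f (S \ φ X) = bot := by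
  classical
  -- a bound above all weights
  set N : ℕ := Finset.univ.sup σ + 1 with hN
  have hσN : ∀ q, σ q < N := fun q => Nat.lt_succ_of_le (Finset.le_sup (f := σ) (mem_univ q))
  -- the certificate data
  let pl : Fin k → Fin k → Bool := fun p _ => decide (p = v)
  let rM : Fin k → Fin k → ℕ := fun p q => if p = v then N + 1 else if q = v then N else σ q
  let rΨ : Fin k → ℕ := fun _ => 0
  let rΦ : Fin k → ℕ := σ
  let a : Finset α → Fin k := fun X => if pl (i X) (j X) then i X else j X
  let b : Finset α → Fin k := fun X => if pl (i X) (j X) then j X else i X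
  -- the three kinds of bads
  have hkind : ∀ X ∈ D,
      (i X = v ∧ j X ≠ v ∧ pl (i X) (j X) = true ∧ a X = v ∧ b X = j X ∧ rM (i X) (j X) = N + 1) ∨
      (i X ≠ v ∧ j X = v ∧ pl (i X) (j X) = false ∧ a X = v ∧ b X = i X ∧ rM (i X) (j X) = N) ∨
      (i X ≠ v ∧ j X ≠ v ∧ σ (i X) < σ (j X) ∧ pl (i X) (j X) = false ∧ a X = j X ∧ b X = i X ∧
        rM (i X) (j X) = σ (j X)) := by
    intro X hX
    by_cases hi : i X = v
    · left
      have hjv : j X ≠ v := fun h => hij X hX (hi.trans h.symm)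
      have hpl : pl (i X) (j X) = true := by simp only [pl, hi, decide_true]
      refine ⟨hi, hjv, hpl, ?_, ?_, ?_⟩
      · show (if pl (i X) (j X) = true then i X else j X) = v
        rw [if_pos hpl, hi]
      · show (if pl (i X) (j X) = true then j X else i X) = j X
        rw [if_pos hpl]
      · show (if i X = v then N + 1 else if j X = v then N else σ (j X)) = N + 1
        rw [if_pos hi]
    · have hpl : pl (i X) (j X) = false := by simp only [pl, hi, decide_false]
      by_cases hj : j X = v
      · right; left
        have hnp : ¬ pl (i X) (j X) = true := by rw [hpl]; exact Bool.false_ne_true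
        refine ⟨hi, hj, hpl, ?_, ?_, ?_⟩
        · show (if pl (i X) (j X) = true then i X else j X) = v
          rw [if_neg hnp, hj]
        · show (if pl (i X) (j X) = true then j X else i X) = i X
          rw [if_neg hnp]
        · show (if i X = v then N + 1 else if j X = v then N else σ (j X)) = N
          rw [if_neg hi, if_pos hj]
      · right; right
        have hlt : σ (i X) < σ (j X) := by
          rcases hT X hX with h | h | h
          · exact absurd h hi
          · exact absurd h hj
          · exact h
        have hnp : ¬ pl (i X) (j X) = true := by rw [hpl]; exact Bool.false_ne_true
        refine ⟨hi, hj, hlt, hpl, ?_, ?_, ?_⟩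
        · show (if pl (i X) (j X) = true then i X else j X) = j X
          rw [if_neg hnp]
        · show (if pl (i X) (j X) = true then j X else i X) = i X
          rw [if_neg hnp]
        · show (if i X = v then N + 1 else if j X = v then N else σ (j X)) = σ (j X)
          rw [if_neg hi, if_neg hj]
  refine exists_injective_good_above_of_twoSidedCertCoInt S D (∅ : Finset (Fin k)) (univ.erase v) hf i j hDS hDi hDj
    pl rM rΨ rΦ a b (fun _ _ => rfl) (fun _ _ => rfl) hij hco ?_ ?_ ?_
  · -- member / member
    intro X hX X' hX'
    have hS₀ : ∀ q : Fin k, q ∈ univ.erase v ↔ q ≠ v := fun q => by simp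
    rcases hkind X hX with ⟨hiX, hjX, hplX, haX, hbX, hrX⟩ | ⟨hiX, hjX, hplX, haX, hbX, hrX⟩ |
        ⟨hiX, hjX, hltX, hplX, haX, hbX, hrX⟩ <;>
      rcases hkind X' hX' with ⟨hiX', hjX', hplX', haX', hbX', hrX'⟩ | ⟨hiX', hjX', hplX', haX', hbX', hrX'⟩ |
        ⟨hiX', hjX', hltX', hplX', haX', hbX', hrX'⟩ <;>
      rw [hrX, hrX', hplX, hplX', haX, hbX, haX', hbX'] <;>
      refine ⟨fun hle => ⟨fun h => ?_, ?_⟩, fun hlt => ?_⟩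
    -- plain / plain
    · exact h
    · exact Or.inl ⟨fun h => hjX' h.symm, fun h => hjX h⟩
    · exact absurd hlt (lt_irrefl _)
    -- plain / comp-v : rank N+1 ≤ N impossible
    · exact absurd hle (by omega)
    · exact absurd hle (by omega)
    · exact absurd hlt (by omega)
    -- plain / comp-up : rank N+1 ≤ σ q' impossible
    · exact absurd hle (by have := hσN (j X'); omega)
    · exact absurd hle (by have := hσN (j X'); omega)
    · exact absurd hlt (by have := hσN (j X'); omega)
    -- comp-v / plain
    · exact absurd h (by simp)
    · exact Or.inl ⟨fun h => hjX' h.symm, fun h => hiX h⟩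
    · -- equal label pairs possible (the opposite pair (p,v),(v,p)): co-intersection clause
      exact Or.inr ⟨rfl, rfl⟩
    -- comp-v / comp-v
    · exact absurd h (by simp)
    · exact Or.inl ⟨fun h => hiX' h.symm, fun h => hiX h⟩
    · exact absurd hlt (lt_irrefl _)
    -- comp-v / comp-up : N ≤ σ q' impossible
    · exact absurd hle (by have := hσN (j X'); omega)
    · exact absurd hle (by have := hσN (j X'); omega)
    · exact absurd hlt (by have := hσN (j X'); omega)
    -- comp-up / plain
    · exact absurd h (by simp)
    · by_cases hq : j X = j X'
      · exact Or.inr (Or.inr ⟨hq, fun h => hiX h, (hS₀ _).2 hjX⟩)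
      · exact Or.inl ⟨hq, fun h => hiX h⟩
    · exact Or.inl fun h => hjX h.1
    -- comp-up / comp-v
    · exact absurd h (by simp)
    · by_cases hq : j X = i X'
      · exact Or.inr (Or.inr ⟨hq, fun h => hiX h, (hS₀ _).2 hjX⟩)
      · exact Or.inl ⟨hq, fun h => hiX h⟩
    · exact Or.inl fun h => hjX h.1
    -- comp-up / comp-up
    · exact absurd h (by simp)
    · by_cases hq : j X = i X'
      · refine Or.inr (Or.inr ⟨hq, fun h => ?_, (hS₀ _).2 hjX⟩)
        -- i X = j X' would give σ (j X') = σ (i X) < σ (j X) ≤ σ (j X')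
        rw [h] at hltX
        exact absurd (lt_of_lt_of_le hltX hle) (lt_irrefl _)
      · refine Or.inl ⟨hq, fun h => ?_⟩
        rw [h] at hltX
        exact absurd (lt_of_lt_of_le hltX hle) (lt_irrefl _)
    · exact Or.inl fun h => by rw [h.1] at hlt; exact lt_irrefl _ hlt
  · -- member / Ψ : `R = ∅`
    intro X hX r hr
    exact absurd hr (by simp)
  · -- member / Φ_s
    intro X hX s hs
    have hsv : s ≠ v := by simpa using hs
    have hS₀ : ∀ q : Fin k, q ∈ univ.erase v ↔ q ≠ v := fun q => by simp
    show (rM (i X) (j X) ≤ σ s → _) ∧ (σ s < rM (i X) (j X) → _)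
    rcases hkind X hX with ⟨hiX, hjX, hplX, haX, hbX, hrX⟩ | ⟨hiX, hjX, hplX, haX, hbX, hrX⟩ |
        ⟨hiX, hjX, hltX, hplX, haX, hbX, hrX⟩ <;>
      rw [hrX, hplX, haX, hbX] <;> refine ⟨fun hle => ?_, fun hlt => ?_⟩
    · exact absurd hle (by have := hσN s; omega)
    · exact fun h => hsv h
    · exact absurd hle (by have := hσN s; omega)
    · exact fun h => hsv h
    · refine ⟨rfl, fun h => ?_, (hS₀ _).2 hjX⟩
      rw [h] at hltX
      exact absurd (lt_of_lt_of_le hltX hle) (lt_irrefl _)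
    · exact fun h => by rw [h] at hlt; exact lt_irrefl _ hlt

/-- Opposite-free families are co-intersecting: if no two bads of `D` have opposite types then `X ∪ X' ≠ S` for all
`X, X' ∈ D`.  (So `exists_injective_good_above_of_coint_starAcyclic` applies to every opposite-free family whose types avoiding
`v` are acyclic — in particular to acyclic type digraphs and to the cyclic triangle through `v`.) -/
theorem union_ne_of_oppositeFree (S : Finset α) {f : Finset α → Lab k}
    (hf : ∀ ⦃X Y : Finset α⦄, X ⊆ Y → f X ≤ f Y) (D : Finset (Finset α)) (i j : Finset α → Fin k)
    (hDi : ∀ X ∈ D, f X = petal (i X)) (hDj : ∀ X ∈ D, f (S \ X) = petal (j X))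
    (hOpp : ∀ X ∈ D, ∀ X' ∈ D, ¬ (i X = j X' ∧ j X = i X')) :
    ∀ X ∈ D, ∀ X' ∈ D, X ∪ X' ≠ S := by
  intro X hX X' hX' hU
  have h1 : S \ X ⊆ X' := by
    intro x hx
    have hxS : x ∈ S := (mem_sdiff.1 hx).1
    rw [← hU] at hxS
    rcases mem_union.1 hxS with h | h
    · exact absurd h (mem_sdiff.1 hx).2
    · exact h
  have h2 : S \ X' ⊆ X := by
    intro x hx
    have hxS : x ∈ S := (mem_sdiff.1 hx).1
    rw [← hU] at hxS
    rcases mem_union.1 hxS with h | h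
    · exact h
    · exact absurd h (mem_sdiff.1 hx).2
  have e1 := eq_of_petal_le_petal ((hDj X hX) ▸ (hDi X' hX') ▸ hf h1)
  have e2 := eq_of_petal_le_petal ((hDj X' hX') ▸ (hDi X hX) ▸ hf h2)
  exact hOpp X hX X' hX' ⟨e2.symm, e1⟩

end OrientedAntipodalHall

end Summit.CriticalPhenomena.PercolationContinuityZ3.Theorems
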